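import Literature.Geometry.Riemannian.CurvatureDecomposition
import Literature.Topology.FourManifolds.OrientationSign
import HarnessLib

/-!
# Self-dual (half conformally flat) Riemannian 4-manifolds, frame-wise

Topic `Literature/Geometry/Riemannian` (definition item `defn-IsSelfDualWith`, for route
`SmoothPoincare4/TwistorDissolution`; common vocabulary for routes `PIC` and `WeylBudget`).

On an oriented Riemannian 4-manifold the curvature operator on `Λ² = Λ²₊ ⊕ Λ²₋` is the block
matrix `(A B; ᵗB C)` with `A = W⁺ + (s/12)·1`, `C = W⁻ + (s/12)·1`, `B =` trace-free Ricci
(Atiyah–Hitchin–Singer 1978, §1, (1.4)–(1.5); Besse 1987, 1.126–1.128; Hamilton 1997, §1.2); the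
metric is **self-dual** (for the given orientation) if `W⁻ = 0`, **anti-self-dual** if `W⁺ = 0`, and
**half conformally flat** if one of the two holds; reversing the orientation interchanges `Λ²₊`
and `Λ²₋`, hence `W⁺` and `W⁻` (AHS 1978, §1; LeBrun, p. 81). `W⁻ = 0` says that `C` is a scalar
matrix (then necessarily `C = (tr C / 3)·1 = (s/12)·1`, `tr W⁻ = 0`).

Everything here is frame-wise, over the tree's Hamilton blocks `blockA`, `blockC` of an
(orthonormal) 4-frame (`CurvatureDecomposition.lean`: `φᵢ`, `ψᵢ` Hamilton's bases of `Λ²₊`, `Λ²₋`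
attached to the frame) and the tree's orientation character of a frame
`SmoothOrientation.IsPosFrame` (`OrientationSign.lean`):

* `g.IsSelfDualWith o` — for the Riemannian (pseudo-Riemannian) metric `g` on a smooth 4-manifold
  `M` with `[g.HasLeviCivita]` and a smooth orientation `o`: in EVERY positively oriented
  `g`-orthonormal frame `e` at every point, Hamilton's block `C = (R(ψᵢ, ψⱼ))` of the Levi-Civita
  curvature is scalar, `C = (tr C / 3)·1`. (Quantifying over all positive orthonormal frames renders
  the tensor identity `W⁻ ≡ 0` without having to prove frame independence; for one frame per point
  it is the same condition, by `SO(3)`-equivariance of `C` — not proved here.)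
* `g.IsHalfConformallyFlat := ∃ o, g.IsSelfDualWith o`.
* General-connection versions `IsSelfDualWithOf cov o` (any covariant derivative `cov` in place of
  `g.leviCivita`), through which the lemmas are proved.

## API (proved)

* `isSelfDualWith_iff`, `IsSelfDualWith.blockC_eq`, `IsSelfDualWith.isHalfConformallyFlat`.
* **Orientation reversal exchanges `A` and `C`** (`isSelfDualWithOf_neg_iff`,
  `isSelfDualWith_neg_iff`): `g.IsSelfDualWith (-o) ↔` in every positively `o`-oriented orthonormal
  frame the block `A` is scalar (i.e. `W⁺ = 0`: anti-self-duality for `o`). Mechanism: swapping the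
  last two vectors of a frame `e ↦ e ∘ (2 3)` reverses its orientation character
  (`det_frameOfFin_comp_swap`, `SmoothOrientation.sign_neg`) and turns Hamilton's self-dual basis
  into his anti-self-dual one up to the reindexing `(1 2)` (`selfDualPairs_comp_swap`,
  `antiSelfDualPairs_comp_swap`), so `A(e ∘ (2 3)) = C(e)` and `C(e ∘ (2 3)) = A(e)` reindexed
  (`blockA_comp_swap`, `blockC_comp_swap`), and being scalar is invariant under reindexing
  (`Matrix.submatrix_eq_trace_div_smul_one_iff`).

## Not here (follow-ups)

Frame independence at a point (one positive orthonormal frame per point suffices), conformal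
invariance of `IsSelfDualWith` (`W` is conformally invariant, AHS 1978 §1), and "locally
conformally flat ⟹ self-dual for both orientations" (`W = 0`; `ConformallyFlat.lean`) are genuine
theorems about the Weyl tensor and are not proved in this definitional file.

## References

* M. F. Atiyah, N. J. Hitchin, I. M. Singer, *Self-duality in four-dimensional Riemannian
  geometry*, Proc. R. Soc. Lond. A 362 (1978) 425–461, §1. [AtiyahHitchinSinger1978]
* A. L. Besse, *Einstein Manifolds* (1987), 1.126–1.128. [Besse1987]
* R. S. Hamilton, *Four-manifolds with positive isotropic curvature*, Comm. Anal. Geom. 5 (1997),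
  §1.2 (blocks `A`, `B`, `C`). [Hamilton1997]
* C. LeBrun, *Four-manifolds without Einstein metrics / curvature functionals* (2017 survey), p. 81
  (self-dual, anti-self-dual; orientation reversal). [LeBrun2017]
-/

open scoped Manifold ContDiff Topology
open Function Module

noncomputable section

/-! ### A matrix lemma: being scalar is invariant under reindexing -/

namespace Matrix

/-- Reindexing a square matrix along an equivalence does not change its trace (a private copy
of the tree's `Matrix.trace_submatrix_equiv`, `HalfFillingGaussianDomination.lean`, not imported
here). [folklore] -/
private theorem trace_submatrix_equiv_aux {m R : Type*} [Fintype m] [AddCommMonoid R] (A : Matrix m m R)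
    (π : m ≃ m) : (A.submatrix π π).trace = A.trace := by
  simp only [Matrix.trace, Matrix.diag, Matrix.submatrix_apply]
  exact Equiv.sum_comp π (fun i => A i i)

/-- A square matrix is the scalar matrix `(tr A / 3)·1` iff some (any) reindexing of it along an
equivalence is: being scalar is invariant under a change of basis by a permutation. [folklore] -/
theorem submatrix_eq_trace_div_smul_one_iff {m : Type*} [Fintype m] [DecidableEq m]
    (A : Matrix m m ℝ) (π : m ≃ m) (d : ℝ) :
    A.submatrix π π = ((A.submatrix π π).trace / d) • (1 : Matrix m m ℝ) ↔
      A = (A.trace / d) • (1 : Matrix m m ℝ) := by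
  rw [trace_submatrix_equiv_aux]
  constructor
  · intro h
    have h' := congrArg (fun B : Matrix m m ℝ => B.submatrix π.symm π.symm) h
    simp only [submatrix_submatrix, Equiv.self_comp_symm, submatrix_id_id, submatrix_smul,
      Pi.smul_apply, submatrix_one_equiv] at h'
    exact h'
  · intro h
    conv_lhs => rw [h]
    ext i j
    simp only [submatrix_apply, smul_apply, one_apply, EmbeddingLike.apply_eq_iff_eq]

end Matrix

namespace Literature.Topology.FourManifolds.SmoothOrientation

variable {E H : Type*} [NormedAddCommGroup E] [NormedSpace ℝ E] [FiniteDimensional ℝ E]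
  [TopologicalSpace H] {I : ModelWithCorners ℝ E H}
  {M : Type*} [TopologicalSpace M] [ChartedSpace H M] [IsManifold I 1 M]

/-- The opposite orientation has the opposite sign at every point. [folklore] -/
theorem sign_neg (o : SmoothOrientation I M) (x : M) : (-o).sign x = -o.sign x := by
  unfold sign
  split_ifs with h1 h2 h2
  · exfalso
    rw [neg_apply, h2] at h1
    exact (Module.Ray.ne_neg_self _) h1.symm
  · norm_num
  · rfl
  · exfalso
    apply h1
    rw [neg_apply, ((finBasis ℝ E).orientation_ne_iff_eq_neg (o x)).1 h2]
    exact _root_.neg_neg ((finBasis ℝ E).orientation)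

/-- A frame is positive for `-o` iff its orientation character for `o` is negative:
`0 < -(sign o) · det v`. [folklore] -/
theorem isPosFrame_neg_iff (o : SmoothOrientation I M) (x : M) (v : Fin (finrank ℝ E) → E) :
    (-o).IsPosFrame x v ↔ 0 < -(o.sign x * (finBasis ℝ E).det v) := by
  rw [IsPosFrame, sign_neg, neg_mul]

end Literature.Topology.FourManifolds.SmoothOrientation

namespace Literature.Geometry.Riemannian

open Literature.Geometry.Lorentzian (PseudoRiemannianMetric)
open Literature.Geometry.Lorentzian.PseudoRiemannianMetric
open Literature.Topology.FourManifolds (SmoothOrientation)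

/-! ### Hamilton's bases under the swap of the last two frame vectors -/

section Blocks

variable {E : Type*} [NormedAddCommGroup E] [NormedSpace ℝ E] {H : Type*} [TopologicalSpace H]
  {I : ModelWithCorners ℝ E H} {M : Type*} [TopologicalSpace M] [ChartedSpace H M]
  [IsManifold I ∞ M] {n : ℕ∞ω}

variable (g : PseudoRiemannianMetric I n E (TangentSpace I : M → Type _))
  (cov : CovariantDerivative I E (TangentSpace I : M → Type _))

omit [IsManifold I ∞ M] in
/-- Swapping `X₃ ↔ X₄` turns Hamilton's self-dual basis `(φ₁, φ₂, φ₃)` of the new frame into the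
anti-self-dual basis `(ψ₁, ψ₃, ψ₂)` of the old one (literally, as lists of pairs).
[cite: Hamilton1997, §1.2, p. 5] -/
theorem selfDualPairs_comp_swap {x : M} (e : Fin 4 → TangentSpace I x) :
    selfDualPairs (e ∘ Equiv.swap (2 : Fin 4) 3) =
      fun i => antiSelfDualPairs e (Equiv.swap (1 : Fin 3) 2 i) := by
  funext i
  fin_cases i <;> rfl

omit [IsManifold I ∞ M] in
/-- Swapping `X₃ ↔ X₄` turns Hamilton's anti-self-dual basis of the new frame into the self-dual
basis `(φ₁, φ₃, φ₂)` of the old one. [cite: Hamilton1997, §1.2, p. 5] -/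
theorem antiSelfDualPairs_comp_swap {x : M} (e : Fin 4 → TangentSpace I x) :
    antiSelfDualPairs (e ∘ Equiv.swap (2 : Fin 4) 3) =
      fun i => selfDualPairs e (Equiv.swap (1 : Fin 3) 2 i) := by
  funext i
  fin_cases i <;> rfl

/-- **Reversing the orientation of the frame exchanges `A` and `C`**: the block `A` of the frame
`(X₁, X₂, X₄, X₃)` is the block `C` of `(X₁, X₂, X₃, X₄)` reindexed by `(1 2)`.
[cite: Hamilton1997, §1.2, p. 5] -/
theorem blockA_comp_swap (x : M) (e : Fin 4 → TangentSpace I x) :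
    g.blockA cov x (e ∘ Equiv.swap (2 : Fin 4) 3) =
      (g.blockC cov x e).submatrix (Equiv.swap (1 : Fin 3) 2) (Equiv.swap (1 : Fin 3) 2) := by
  ext i j
  simp only [blockA, blockC, Matrix.of_apply, Matrix.submatrix_apply, selfDualPairs_comp_swap]

/-- Dually, the block `C` of `(X₁, X₂, X₄, X₃)` is the block `A` of `(X₁, X₂, X₃, X₄)` reindexed.
[cite: Hamilton1997, §1.2, p. 5] -/
theorem blockC_comp_swap (x : M) (e : Fin 4 → TangentSpace I x) :
    g.blockC cov x (e ∘ Equiv.swap (2 : Fin 4) 3) =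
      (g.blockA cov x e).submatrix (Equiv.swap (1 : Fin 3) 2) (Equiv.swap (1 : Fin 3) 2) := by
  ext i j
  simp only [blockA, blockC, Matrix.of_apply, Matrix.submatrix_apply, antiSelfDualPairs_comp_swap]

variable {g} in
/-- A permuted orthonormal frame is orthonormal. [folklore] -/
theorem _root_.Literature.Geometry.Lorentzian.PseudoRiemannianMetric.IsOrthonormalFrame.comp_equiv
    {ι : Type*} {x : M} {e : ι → TangentSpace I x} (h : g.IsOrthonormalFrame x e) (σ : ι ≃ ι) :
    g.IsOrthonormalFrame x (e ∘ σ) :=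
  h.comp σ.injective

end Blocks

/-! ### Self-duality -/

section SelfDual

variable {M : Type*} [TopologicalSpace M] [ChartedSpace (EuclideanSpace ℝ (Fin 4)) M]
  [IsManifold (𝓡 4) ∞ M]

/-- The frame `e : Fin 4 → T_x M` re-indexed by `Fin (finrank ℝ ℝ⁴)`, the index type of the
tree's orientation character `SmoothOrientation.IsPosFrame` (`finrank_euclideanSpace_fin`). [folklore] -/
abbrev frameOfFin {x : M} (e : Fin 4 → TangentSpace (𝓡 4) x) :
    Fin (finrank ℝ (EuclideanSpace ℝ (Fin 4))) → EuclideanSpace ℝ (Fin 4) :=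
  fun i => e (Fin.cast finrank_euclideanSpace_fin i)

omit [IsManifold (𝓡 4) ∞ M] in
/-- Swapping two vectors of a frame negates its determinant in the reference basis
(`AlternatingMap.map_swap`). [folklore] -/
theorem det_frameOfFin_comp_swap {x : M} (e : Fin 4 → TangentSpace (𝓡 4) x) :
    (finBasis ℝ (EuclideanSpace ℝ (Fin 4))).det (frameOfFin (e ∘ Equiv.swap (2 : Fin 4) 3)) =
      -(finBasis ℝ (EuclideanSpace ℝ (Fin 4))).det (frameOfFin e) := by
  set h := (finrank_euclideanSpace_fin : finrank ℝ (EuclideanSpace ℝ (Fin 4)) = 4) with hh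
  have hne : Fin.cast h.symm (2 : Fin 4) ≠ Fin.cast h.symm 3 := by
    intro h23
    have := congrArg Fin.val h23
    simp at this
  have key : frameOfFin (e ∘ Equiv.swap (2 : Fin 4) 3) =
      frameOfFin e ∘ Equiv.swap (Fin.cast h.symm (2 : Fin 4)) (Fin.cast h.symm 3) := by
    funext i
    simp only [frameOfFin, comp_apply]
    have e2 : Fin.cast h (Fin.cast h.symm (2 : Fin 4)) = 2 := rfl
    have e3 : Fin.cast h (Fin.cast h.symm (3 : Fin 4)) = 3 := rfl
    rw [(Fin.cast_injective h).map_swap, e2, e3]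
  rw [key]
  exact AlternatingMap.map_swap _ _ hne

variable (g : PseudoRiemannianMetric (𝓡 4) ∞ (EuclideanSpace ℝ (Fin 4)) (TangentSpace (𝓡 4) : M → Type _))

/-- **Self-duality with respect to a connection** (general version of `IsSelfDualWith`, for any
covariant derivative `cov` on `TM` in place of the Levi-Civita connection): in every positively
`o`-oriented `g`-orthonormal frame Hamilton's block `C = (R(ψᵢ, ψⱼ))` of the curvature of `cov` is a
scalar matrix, `C = (tr C / 3)·1` — the frame-wise form of `W⁻ ≡ 0`.
[cite: AtiyahHitchinSinger1978, §1] -/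
def _root_.Literature.Geometry.Lorentzian.PseudoRiemannianMetric.IsSelfDualWithOf
    (cov : CovariantDerivative (𝓡 4) (EuclideanSpace ℝ (Fin 4)) (TangentSpace (𝓡 4) : M → Type _))
    (o : SmoothOrientation (𝓡 4) M) : Prop :=
  ∀ (x : M) (e : Fin 4 → TangentSpace (𝓡 4) x), g.IsOrthonormalFrame x e →
    o.IsPosFrame x (frameOfFin e) →
      g.blockC cov x e = ((g.blockC cov x e).trace / 3) • (1 : Matrix (Fin 3) (Fin 3) ℝ)

variable [g.HasLeviCivita]

/-- **The metric `g` is self-dual for the orientation `o`** (`W⁻ ≡ 0`; Atiyah–Hitchin–Singer 1978,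
§1: "`W = W⁺ + W⁻` […] we say the metric is self-dual if `W⁻ = 0`"; Besse 1.128; in Hamilton's
blocks `C = W⁻ + (s/12)·1`): in every positively `o`-oriented `g`-orthonormal frame `e` at every
point, the block `C = (R(ψᵢ, ψⱼ))` of the Levi-Civita curvature in Hamilton's anti-self-dual basis
`ψ₁ = X₁∧X₂ - X₃∧X₄, ψ₂ = X₁∧X₃ - X₄∧X₂, ψ₃ = X₁∧X₄ - X₂∧X₃` is a scalar matrix,
`C = (tr C / 3)·1`. The frame is read in the preferred chart (`TangentSpace (𝓡 4) x = ℝ⁴`) and its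
orientation character is the tree's `SmoothOrientation.IsPosFrame` (through `frameOfFin`,
`Fin 4 = Fin (finrank ℝ ℝ⁴)`). Reversing `o` gives anti-self-duality (`W⁺ ≡ 0`, block `A` scalar:
`isSelfDualWith_neg_iff`). [cite: AtiyahHitchinSinger1978, §1] [cite: Besse1987, 1.126–1.128] -/
def _root_.Literature.Geometry.Lorentzian.PseudoRiemannianMetric.IsSelfDualWith
    (o : SmoothOrientation (𝓡 4) M) : Prop :=
  g.IsSelfDualWithOf g.leviCivita o

/-- **Half conformally flat**: self-dual for one of the two orientations (`W⁺ = 0` or `W⁻ = 0`;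
Besse 1.128; LeBrun p. 81). [cite: Besse1987, 1.128] -/
def _root_.Literature.Geometry.Lorentzian.PseudoRiemannianMetric.IsHalfConformallyFlat
    (g' : PseudoRiemannianMetric (𝓡 4) ∞ (EuclideanSpace ℝ (Fin 4)) (TangentSpace (𝓡 4) : M → Type _))
    [g'.HasLeviCivita] : Prop :=
  ∃ o : SmoothOrientation (𝓡 4) M, g'.IsSelfDualWith o

variable {g}

/-- Unfolding of self-duality. [cite: AtiyahHitchinSinger1978, §1] -/
theorem _root_.Literature.Geometry.Lorentzian.PseudoRiemannianMetric.isSelfDualWith_iff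
    (o : SmoothOrientation (𝓡 4) M) :
    g.IsSelfDualWith o ↔
      ∀ (x : M) (e : Fin 4 → TangentSpace (𝓡 4) x), g.IsOrthonormalFrame x e →
        o.IsPosFrame x (frameOfFin e) →
          g.blockC g.leviCivita x e =
            ((g.blockC g.leviCivita x e).trace / 3) • (1 : Matrix (Fin 3) (Fin 3) ℝ) :=
  Iff.rfl

/-- In a positive orthonormal frame of a self-dual metric, `C = (tr C / 3)·1`.
[cite: AtiyahHitchinSinger1978, §1] -/
theorem _root_.Literature.Geometry.Lorentzian.PseudoRiemannianMetric.IsSelfDualWith.blockC_eq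
    {o : SmoothOrientation (𝓡 4) M} (h : g.IsSelfDualWith o) {x : M}
    {e : Fin 4 → TangentSpace (𝓡 4) x} (he : g.IsOrthonormalFrame x e)
    (ho : o.IsPosFrame x (frameOfFin e)) :
    g.blockC g.leviCivita x e =
      ((g.blockC g.leviCivita x e).trace / 3) • (1 : Matrix (Fin 3) (Fin 3) ℝ) :=
  h x e he ho

/-- A self-dual metric is half conformally flat. [cite: Besse1987, 1.128] -/
theorem _root_.Literature.Geometry.Lorentzian.PseudoRiemannianMetric.IsSelfDualWith.isHalfConformallyFlat
    {o : SmoothOrientation (𝓡 4) M} (h : g.IsSelfDualWith o) : g.IsHalfConformallyFlat :=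
  ⟨o, h⟩

omit [g.HasLeviCivita] in
/-- **Orientation reversal exchanges the blocks `A` and `C`** (general connection): `g` is
self-dual for `-o` with respect to `cov` iff in every positively `o`-oriented orthonormal frame the
block `A = (R(φᵢ, φⱼ))` is scalar — anti-self-duality, `W⁺ ≡ 0` (AHS 1978, §1: reversing the
orientation interchanges `Λ²₊` and `Λ²₋`). Proof: pass from `e` to `e ∘ (2 3)`, which is orthonormal,
has the opposite orientation character, and whose `C`-block is the `A`-block of `e` reindexed.
[cite: AtiyahHitchinSinger1978, §1] -/
theorem _root_.Literature.Geometry.Lorentzian.PseudoRiemannianMetric.isSelfDualWithOf_neg_iff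
    (cov : CovariantDerivative (𝓡 4) (EuclideanSpace ℝ (Fin 4)) (TangentSpace (𝓡 4) : M → Type _))
    (o : SmoothOrientation (𝓡 4) M) :
    g.IsSelfDualWithOf cov (-o) ↔
      ∀ (x : M) (e : Fin 4 → TangentSpace (𝓡 4) x), g.IsOrthonormalFrame x e →
        o.IsPosFrame x (frameOfFin e) →
          g.blockA cov x e = ((g.blockA cov x e).trace / 3) • (1 : Matrix (Fin 3) (Fin 3) ℝ) := by
  constructor
  · intro h x e he ho
    have he' := he.comp_equiv (Equiv.swap (2 : Fin 4) 3)
    have ho' : (-o).IsPosFrame x (frameOfFin (e ∘ Equiv.swap (2 : Fin 4) 3)) := by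
      rw [SmoothOrientation.isPosFrame_neg_iff, det_frameOfFin_comp_swap, mul_neg, neg_neg]
      exact ho
    have hC := h x _ he' ho'
    rw [blockC_comp_swap] at hC
    exact (Matrix.submatrix_eq_trace_div_smul_one_iff _ _ 3).1 hC
  · intro h x e he ho
    have he' := he.comp_equiv (Equiv.swap (2 : Fin 4) 3)
    have ho' : o.IsPosFrame x (frameOfFin (e ∘ Equiv.swap (2 : Fin 4) 3)) := by
      rw [SmoothOrientation.IsPosFrame, det_frameOfFin_comp_swap, mul_neg]
      rw [SmoothOrientation.isPosFrame_neg_iff] at ho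
      exact ho
    have hA := h x _ he' ho'
    rw [blockA_comp_swap] at hA
    exact (Matrix.submatrix_eq_trace_div_smul_one_iff _ _ 3).1 hA

/-- **Reversing the orientation exchanges self-duality and anti-self-duality**: `g` is self-dual
for `-o` iff in every positively `o`-oriented `g`-orthonormal frame Hamilton's block
`A = (R(φᵢ, φⱼ))` of the Levi-Civita curvature is scalar (`W⁺ ≡ 0`).
[cite: AtiyahHitchinSinger1978, §1] -/
theorem _root_.Literature.Geometry.Lorentzian.PseudoRiemannianMetric.isSelfDualWith_neg_iff
    (o : SmoothOrientation (𝓡 4) M) :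
    g.IsSelfDualWith (-o) ↔
      ∀ (x : M) (e : Fin 4 → TangentSpace (𝓡 4) x), g.IsOrthonormalFrame x e →
        o.IsPosFrame x (frameOfFin e) →
          g.blockA g.leviCivita x e =
            ((g.blockA g.leviCivita x e).trace / 3) • (1 : Matrix (Fin 3) (Fin 3) ℝ) :=
  isSelfDualWithOf_neg_iff g.leviCivita o

/-- If both `W⁺` and `W⁻` vanish frame-wise (blocks `A` and `C` scalar in every orthonormal frame,
e.g. for a metric of constant curvature), then `g` is self-dual for every orientation.
[cite: AtiyahHitchinSinger1978, §1] -/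
theorem _root_.Literature.Geometry.Lorentzian.PseudoRiemannianMetric.isSelfDualWith_of_forall
    (h : ∀ (x : M) (e : Fin 4 → TangentSpace (𝓡 4) x), g.IsOrthonormalFrame x e →
      g.blockC g.leviCivita x e =
        ((g.blockC g.leviCivita x e).trace / 3) • (1 : Matrix (Fin 3) (Fin 3) ℝ))
    (o : SmoothOrientation (𝓡 4) M) : g.IsSelfDualWith o :=
  fun x e he _ => h x e he

end SelfDual

end Literature.Geometry.Riemannian

end
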